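import Literature.NumberTheory.LFunctions.Zhang2022.RepairRplusTightness

/-!
# Zhang (2022), programme F-S3 §E (cell landau-siegel, barrier extension, seat p3): what survives of the
# RANK-ONE tail coupling WITHOUT smoothness — rough (non-smooth / multi-piece) overhang pieces, the exact
# criterion of the completed two-piece form, and the family `familyRoughTwoPiece` (`R⁺⁺ = R⁺ ++ [rough]`)

Y. Zhang, *Discrete mean estimates and the Landau–Siegel zero*, arXiv:2211.02515v1 [Zhang2022LandauSiegel] —
an unrefereed manuscript under adjudication. **WHAT THIS IS NOT: not a claim about Theorems 1–2 of
arXiv:2211.02515, about Landau–Siegel zeros, about a repaired `Margin232`, or about Parity; nothing here asserts any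
claim of the manuscript. The programme SEARCHES and TYPES; no claim until a kernel theorem says so.** Companion of
`KnifeEdgeOverhangRankOne` (p442741, the SMOOTH two-piece class: `KnifeEdge.InClassPiece u u'` ⊕
`KnifeEdge.OverhangPiece θ v v'` with `v` continuous on `[0,θ]` — hence `v(1⁺) = 0` — and `v(θ) = 0`), of
`RepairRplus` (p455670, `Repair.not_repairable_in_Rplus`, the class `R⁺` as the list `Repair.Rplus` of
`Repair.DesignFamily`s with `Repair.rplus_extend`) and of `RepairRplusTightness` (`Repair.mainTermForm_gStar`).
This file removes the smoothness of the overhang piece: it may JUMP at the wall `z = log n/log P = 1`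
(`v(1⁺) ≠ 0`), at its top (`v(θ⁻) ≠ 0`) and at finitely many interior breakpoints, and no continuity is asked
anywhere (`RoughOverhangPiece θ v v'`: `v, v′ ∈ L²(1,θ)`, `v = v′ = 0` below `1`, `v′` a right derivative of `v`
on `[1,θ)` off a finite set). The in-class side stays `InClassPiece` (kinked `H¹` on `[0,1]`, any number of kinks,
`u(1) = 0`), so the wall jump of the glued profile `s·u ⊕ v` is `v(1⁺)`.

**What survives, verbatim (Part 2, unconditional).** In the continued formula I `M_θ = Repair.MformTop θ` an in-class
piece `u` and a ROUGH overhang piece `v` still pair only through the rank-one tail term: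
`M_θ(u,v) = π·conj(Φ_v)·L(u)`, `M_θ(v,u) = 0` (`rough_rankOneTailCoupling`, every `θ ≥ 1`;
`Φ_v = KnifeEdge.overhangMass`, `L = KnifeEdge.tailFunctional`). The p442741 proof never used continuity of `v`
at the wall or `v(θ) = 0`: below `1` the `v`-slot of `Repair.dipoleIntegrandTop` is the constant `π²N_j·conj Φ_v`
as soon as `v = v′ = 0` there and `v ∈ L¹(1,θ)`; above `1` the `u`-slot vanishes. (The jump itself is not seen by
the continued calculus; where it enters is the off-diagonal slot `X` of p442741, next paragraph. What lies beyond
`P^{1+ε}` stays pointwise invisible whatever happens at or below the wall: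
`KnifeEdgeInvisibleTail.tailInvisible_of_lipschitzOnWith`, `KnifeEdgeInvisibleTail.band_lt_rpow_one_add`, p455698.)

**The exact criterion (Part 3, pure algebra, for ANY class `V` of overhang pieces).** With the off-diagonal slot
`X : KnifeEdge.PairFunctional` the would-be constant of the design `s·u ⊕ v` is
`q_X(s) = 𝔅(u)|s|² + 2Re(s·c_X(u,v)) + r_X(v)` (`twoPieceMainTerm_eq_pencil`), where
`c_X(u,v) := π·conj(Φ_v)·L(u) + X(u,v)` (`crossResidual`, the CROSS RESIDUAL; `= 0` in the invisible world; for a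
piece with `v(1⁺) ≠ 0` it is the bulk × band cross term — row E-006 «E*-cross» of the cell's registry
`obj/EDREGISTRY.md`) and `r_X(v) := Re 𝔅_θ(v) + 2Re X(v,v)` (`netOverhangBlock`, the NET OVERHANG BLOCK; `= 0` in
the invisible world; for `v(1⁺) ≠ 0` it carries the band variance — row E-005 «E*-band»; its sign `+` is the
positivity lever (B1) of the cell's LEVERS §0.6, a claim about the true discrete mean that is NOT a theorem of the
tree — displayed here as the slot `BandNonnegOn`, never assumed silently). Since `𝔅(u) ≥ 0`
(`mainTermForm_nonneg_of_isH1`): **`NullOn V θ X ↔ BandNonnegOn V θ X ∧ CrossSubordinateOn V θ X`** (`nullOn_iff`):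
the completed form is `≥ 0` on every design of the class iff every net overhang block is `≥ 0` AND every cross
residual is Cauchy–Schwarz-subordinate, `‖c_X(u,v)‖² ≤ 𝔅(u)·r_X(v)` — an iff with `≤`, covering the degenerate
in-class kernel modes `𝔅(u) = 0` (there it forces `c_X(u,v) = 0`: `crossResidual_eq_zero_of_kernelMode`).

**The verdict and the lever (Part 4).** Hence (`not_closesOn`) no design of a class closes by positivity when both
slots hold, and conversely (`closesOn_needs_cross`) a design that closes by positivity in an `X`-world whose band
blocks are `≥ 0` exhibits a pair with `𝔅(u)·r_X(v) < ‖c_X(u,v)‖²`. HONEST READING for the rough class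
(`rough_not_closes`, `rough_closes_needs_cross`, family `familyRoughTwoPiece` with `familyRoughTwoPiece_decided`,
`rplus_rough_decided : ClassDecided (Rplus ++ [familyRoughTwoPiece])`): **closing by positivity in the non-smooth
two-piece class needs `¬(BandNonnegOn ∧ CrossSubordinateOn)` — an off-diagonal input of E*-strength: a negative band
block (against (B1)) or a bulk × band cross term at least the geometric mean of the bulk form and the band block
(the cell's row «E-006⁻»).** Slot-conditional; nothing is «killed» unconditionally.

Part 5: the smooth class of p442741 is the sub-class `OverhangPiece θ ⊆ RoughOverhangPiece θ` (`OverhangPiece.rough`),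
its `Null`/`ClosesByPositivity` are the instances `V = OverhangPiece θ` (`Iff.rfl`), and `InvisibleOverhang θ X` is
exactly `c_X = 0 ∧ r_X = 0` on it (`invisibleOverhang_iff`), so `KnifeEdge.not_closes_of_invisible` is recovered
(`not_closes_of_invisible'`). Part 6: the class is inhabited and strictly larger — the PLATEAU `𝟙_[1,θ)` (jump `1`
at the wall AND at the top) is a rough overhang piece and, for `θ > 1`, not an `OverhangPiece`, while `Repair.phiT θ`
is both; continued-calculus data of the plateau: `Φ = θ − 1`, `M_θ(g⋆, 𝟙) = 24π(θ−1)`, `M_θ(𝟙, g⋆) = 0`,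
`M_θ(𝟙,𝟙) = 32π(θ−1) + 12π²(θ−1)²·i`, `r_0(𝟙) = 64π(θ−1) ≥ 0`. Part 7 (the slots are load-bearing): in the world
`X = 0` — the continued calculus, asserted by no one beyond `P` — the rough class closes by positivity at every
`θ > 1` with `s·g⋆ ⊕ 𝟙_[1,θ)` (`q_0(s) = 48π(θ−1)s + 64π(θ−1)`, e.g. `q_0(−2) = −32π(θ−1)`), the cross slot fails
there (`not_crossSubordinateOn_rough_zero`) while the band slot holds on that member: the knife edge of
`Repair.topForm_indefinite` without the cubic `φ_θ`. CURRENCY (cell rule C3(e)): Parts 6–7 are statements about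
the continued diagonal calculus `Repair.MformTop θ` only; whether such constants are (A)-world main terms off class
`R` is the cell's open dictionary item (registry E-017 / E-002) — validity off `R` open; `X = 0` is not the
(A)-world.

Deliberately NOT here: the glue identity `Re 𝔅_θ(s·u + v) = q_0(s)` (sesquilinear expansion of `M_θ` on the rough
class); in-class pieces with a nonzero LEFT value at the wall (`u(1⁻) ≠ 0`, a sharp cut-off at `n = P` — the
«E-multi-jump» locus of the cell's OBJECTIVE §1.3, sign `+`); several in-class pieces with independent scalars
(the `(m+1)×(m+1)` completed Gram matrix); any instantiation of `X` (the typers' band functional / wall data, rows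
E-005/E-006 — to be plugged into `BandNonnegOn`/`CrossSubordinateOn` when typed). No numeric certificate is used
(structural); axioms standard. References: Zhang, arXiv:2211.02515v1, §7 Prop 7.1, (7.2) p.44, §8 (8.11)–(8.12)
[cite: Zhang2022LandauSiegel, §7 Prop 7.1 (7.2), §8]; cell charter LS-PROGRAMME v1.1 §2 row E,
barrier/ASSIGNMENTS.md row S-E-p3-1.
-/

noncomputable section

open Complex Real ComplexConjugate Set intervalIntegral
open _root_.MeasureTheory

namespace Literature.NumberTheory.LFunctions.Zhang2022

namespace KnifeEdge

open Repair

/-! ### Part 1 — the rough overhang class -/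

/-- A ROUGH overhang piece of logarithmic length `θ` (`n ∈ (P, P^θ]`). Kept: `v ∈ L²(1,θ)` and the marked companion
`v′ ∈ L²(1,θ)` (so every integral of the continued calculus on `[1,θ]` is an honest Lebesgue integral; `L² ⊂ L¹`
there), `v = 0` and `v′ = 0` identically on `(−∞, 1)` (no mass at or below `P` — that side is the in-class piece),
and `v′` is a right derivative of `v` on `[1,θ)` off a finite breakpoint set. NOT asked (this is the point):
continuity at the wall (`v(1⁺) ≠ 0` allowed — a jump of the glued profile at `n = P`), vanishing at the top
(`v(θ⁻) ≠ 0` allowed), continuity across the breakpoints (a multi-piece overhang), any bound on `v`. The smooth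
class `OverhangPiece θ` of p442741 is a sub-class (`OverhangPiece.rough`). [cite: Zhang2022LandauSiegel, Prop 7.1 p.44, (7.2)] -/
structure RoughOverhangPiece (θ : ℝ) (v v' : ℝ → ℂ) : Prop where
  memLp : MemLp v 2 (volume.restrict (Ioc 1 θ))
  memLp' : MemLp v' 2 (volume.restrict (Ioc 1 θ))
  pwDeriv : ∃ J : Finset ℝ, ∀ x ∈ Ico (1:ℝ) θ, x ∉ J → HasDerivWithinAt v (v' x) (Ioi x) x
  vanish : ∀ y, y < 1 → v y = 0
  vanish' : ∀ y, y < 1 → v' y = 0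

/-- A class of overhang pieces — a predicate on the pair `(v, v′)`, e.g. `OverhangPiece θ` (smooth, p442741) or
`RoughOverhangPiece θ`. [cite: Zhang2022LandauSiegel, Prop 7.1 p.44, (7.2)] -/
abbrev PieceClass : Type := (ℝ → ℂ) → (ℝ → ℂ) → Prop

variable {θ : ℝ} {u u' v v' : ℝ → ℂ}

/-- A rough overhang piece is integrable on `[1,θ]` (`L² ⊂ L¹` on a finite interval).
[cite: Zhang2022LandauSiegel, Prop 7.1 p.44, (7.2)] -/
theorem RoughOverhangPiece.intervalIntegrable (hθ : 1 ≤ θ) (hv : RoughOverhangPiece θ v v') :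
    IntervalIntegrable v volume 1 θ :=
  (intervalIntegrable_iff_integrableOn_Ioc_of_le hθ).2 (hv.memLp.integrable one_le_two)

/-- The zero function is an in-class piece. [cite: Zhang2022LandauSiegel, Prop 7.1 p.44, (7.2)] -/
theorem inClassPiece_zero : InClassPiece (fun _ => (0:ℂ)) (fun _ => (0:ℂ)) where
  kinked := kinkedProfile_zero
  vanish := fun _ _ => rfl
  vanish' := fun _ _ => rfl

/-! ### Part 2 — the rank-one tail coupling SURVIVES on the rough class (every `θ ≥ 1`, unconditional) -/

section RankOne

/-- Below `1` the tail of a rough overhang piece is the constant `Φ_v` (no continuity needed: `v = 0` on `(y,1)`).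
[cite: Zhang2022LandauSiegel, Prop 7.1 p.44, (8.11)–(8.12)] -/
theorem rough_tail_eq_overhangMass (hθ : 1 ≤ θ) (hv : RoughOverhangPiece θ v v') {y : ℝ} (hy : y ≤ 1) :
    ∫ t in y..θ, v t = overhangMass θ v := by
  have hEq : EqOn (fun _ => (0:ℂ)) v (uIoo y 1) := by
    intro t ht
    rw [uIoo_of_le hy] at ht
    exact (hv.vanish t ht.2).symm
  have i1 : IntervalIntegrable v volume y 1 := (intervalIntegrable_const (c := (0:ℂ))).congr_uIoo hEq
  have i2 : IntervalIntegrable v volume 1 θ := hv.intervalIntegrable hθ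
  have h0 : ∫ t in y..1, v t = 0 := by
    rw [intervalIntegral.integral_congr_uIoo (g := fun _ => (0:ℂ)) fun t ht => (hEq ht).symm,
      intervalIntegral.integral_zero]
  rw [← intervalIntegral.integral_add_adjacent_intervals i1 i2, h0, zero_add, overhangMass]

/-- One `j`-summand of `M_θ(u,v)` on the rough class: `∫₀^θ D_j = conj(π²N_jΦ_v)·((u(1) − u(0)) + iπj∫₀¹u)`.
[cite: Zhang2022LandauSiegel, Prop 7.1 p.44, (8.11)–(8.12)] -/
theorem rough_integral_dipoleIntegrandTop_inClass (hθ : 1 ≤ θ) (hu : InClassPiece u u')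
    (hv : RoughOverhangPiece θ v v') (j : ℕ) :
    ∫ y in (0:ℝ)..θ, dipoleIntegrandTop θ j u u' v v' y
      = conj ((π : ℂ) ^ 2 * ((bN j : ℝ) : ℂ) * overhangMass θ v)
          * ((u 1 - u 0) + I * π * (j : ℂ) * ∫ t in (0:ℝ)..1, u t) := by
  set D := dipoleIntegrandTop θ j u u' v v' with hD
  set c : ℂ := conj ((π : ℂ) ^ 2 * ((bN j : ℝ) : ℂ) * overhangMass θ v) with hc
  have hEq1 : EqOn D (fun y => c * (u' y + I * π * (j : ℂ) * u y)) (uIoo 0 1) := by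
    intro y hy
    rw [uIoo_of_le zero_le_one] at hy
    simp only [hD, dipoleIntegrandTop, hv.vanish' y hy.2, hv.vanish y hy.2,
      rough_tail_eq_overhangMass hθ hv hy.2.le, hc]
    ring
  have hEq2 : EqOn D (fun _ => (0:ℂ)) (uIoo 1 θ) := by
    intro y hy
    rw [uIoo_of_le hθ] at hy
    simp only [hD, dipoleIntegrandTop, hu.vanish' y hy.1.le, hu.vanish y hy.1.le]
    ring
  have iu' : IntervalIntegrable u' volume 0 1 := hu.kinked.isH1.intervalIntegrable
  have iu : IntervalIntegrable (fun y => I * π * (j : ℂ) * u y) volume 0 1 :=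
    (hu.kinked.cont.intervalIntegrable_of_Icc zero_le_one).const_mul _
  have i1 : IntervalIntegrable D volume 0 1 := ((iu'.add iu).const_mul c).congr_uIoo hEq1.symm
  have i2 : IntervalIntegrable D volume 1 θ :=
    (intervalIntegrable_const (c := (0:ℂ))).congr_uIoo hEq2.symm
  rw [← intervalIntegral.integral_add_adjacent_intervals i1 i2, intervalIntegral.integral_congr_uIoo hEq1,
    intervalIntegral.integral_congr_uIoo hEq2, intervalIntegral.integral_zero, add_zero,
    intervalIntegral.integral_const_mul, intervalIntegral.integral_add iu' iu,
    intervalIntegral.integral_const_mul, integral_deriv_eq_neg hu.kinked (hu.vanish 1 le_rfl),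
    hu.vanish 1 le_rfl]
  ring

/-- One `j`-summand of `M_θ(v,u)` vanishes on the rough class. [cite: Zhang2022LandauSiegel, Prop 7.1 p.44, (8.11)–(8.12)] -/
theorem rough_integral_dipoleIntegrandTop_overhang_inClass (hθ : 1 ≤ θ) (hu : InClassPiece u u')
    (hv : RoughOverhangPiece θ v v') (j : ℕ) :
    ∫ y in (0:ℝ)..θ, dipoleIntegrandTop θ j v v' u u' y = 0 := by
  have h01 : 0 ≤ θ := zero_le_one.trans hθ
  rw [intervalIntegral.integral_congr_uIoo (g := fun _ => (0:ℂ)) fun y hy => ?_, intervalIntegral.integral_zero]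
  rw [uIoo_of_le h01] at hy
  change (v' y + I * π * (j : ℂ) * v y)
      * conj (u' y + I * π * ((bS j : ℝ) : ℂ) * u y + (π : ℂ) ^ 2 * ((bN j : ℝ) : ℂ) * ∫ t in y..θ, u t) = 0
  rcases lt_or_ge y 1 with h | h
  · rw [hv.vanish' y h, hv.vanish y h]; ring
  · rw [hu.vanish' y h, hu.vanish y h, tail_inClass_eq_zero hu h hθ]; simp

/-- **RANK-ONE TAIL COUPLING on the ROUGH class** (every `θ ≥ 1`): `M_θ(u,v) = π·conj(Φ_v)·L(u)` and
`M_θ(v,u) = 0` for an in-class piece `u` and a rough overhang piece `v` — no continuity of `v` at the wall, at the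
top, or anywhere is used; only `v = v′ = 0` below `1` and `v ∈ L¹(1,θ)`. [cite: Zhang2022LandauSiegel, Prop 7.1 p.44, (8.11)–(8.12)] -/
theorem rough_rankOneTailCoupling (hθ : 1 ≤ θ) (hu : InClassPiece u u') (hv : RoughOverhangPiece θ v v') :
    MformTop θ u u' v v' = (π : ℂ) * conj (overhangMass θ v) * tailFunctional u ∧ MformTop θ v v' u u' = 0 := by
  refine ⟨?_, ?_⟩
  · unfold MformTop
    rw [rough_integral_dipoleIntegrandTop_inClass hθ hu hv 1,
      rough_integral_dipoleIntegrandTop_inClass hθ hu hv 2,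
      rough_integral_dipoleIntegrandTop_inClass hθ hu hv 3, bN_one, bN_two, bN_three, tailFunctional]
    have hπ : (π : ℂ) ≠ 0 := by exact_mod_cast Real.pi_ne_zero
    simp only [map_mul, map_pow, Complex.conj_ofReal]
    push_cast
    field_simp
    ring
  · unfold MformTop
    rw [rough_integral_dipoleIntegrandTop_overhang_inClass hθ hu hv 1,
      rough_integral_dipoleIntegrandTop_overhang_inClass hθ hu hv 2,
      rough_integral_dipoleIntegrandTop_overhang_inClass hθ hu hv 3]
    ring

end RankOne

/-! ### Part 3 — the completed two-piece pencil: cross residual, net overhang block, the exact criterion -/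

/-- The CROSS RESIDUAL `c_X(u,v) := π·conj(Φ_v)·L(u) + X(u,v)`: the cross block of the completed two-piece form
(rank-one tail coupling + off-diagonal cross input). `= 0` in the invisible world; for a jump at the wall it is
the bulk × band cross term (cell registry row E-006 «E*-cross»). [cite: Zhang2022LandauSiegel, Prop 7.1 p.44, (7.2)] -/
def crossResidual (θ : ℝ) (X : PairFunctional) (u u' v v' : ℝ → ℂ) : ℂ :=
  (π : ℂ) * conj (overhangMass θ v) * tailFunctional u + X u u' v v'

/-- The NET OVERHANG BLOCK `r_X(v) := Re 𝔅_θ(v) + 2 Re X(v,v)`: the continued diagonal form of the overhang piece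
plus its off-diagonal input. `= 0` in the invisible world; for a jump at the wall it carries the band variance
(cell registry row E-005 «E*-band»; its sign `+` is the lever (B1) of the cell's LEVERS §0.6 — a claim about the
true discrete mean, NOT a theorem here; displayed below as `BandNonnegOn`). [cite: Zhang2022LandauSiegel, Prop 7.1 p.44, (7.2)] -/
def netOverhangBlock (θ : ℝ) (X : PairFunctional) (v v' : ℝ → ℂ) : ℝ :=
  (topDiagForm θ v v').re + 2 * (X v v' v v').re

/-- `q_X(s) = 𝔅(u)·|s|² + 2Re(s·c_X(u,v)) + r_X(v)` — the two-piece constant of p442741 as a pencil in the scalar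
`s`. [cite: Zhang2022LandauSiegel, Prop 7.1 p.44, (7.2)] -/
theorem twoPieceMainTerm_eq_pencil (θ : ℝ) (X : PairFunctional) (u u' v v' : ℝ → ℂ) (s : ℂ) :
    twoPieceMainTerm θ X u u' v v' s
      = mainTermForm u u' * ‖s‖ ^ 2 + 2 * (s * crossResidual θ X u u' v v').re + netOverhangBlock θ X v v' := by
  unfold twoPieceMainTerm crossResidual netOverhangBlock
  ring

/-- The scalar criterion: for `a ≥ 0`, `a|s|² + 2Re(s·c) + r ≥ 0` for every complex `s` iff `r ≥ 0` and
`|c|² ≤ a·r` (completing the square along the ray `s = t·conj c`; for `a = 0` positivity forces `c = 0`).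
Private helper. [folklore] -/
private theorem quadratic_nonneg_iff {a r : ℝ} {c : ℂ} (ha : 0 ≤ a) :
    (∀ s : ℂ, 0 ≤ a * ‖s‖ ^ 2 + 2 * (s * c).re + r) ↔ (0 ≤ r ∧ ‖c‖ ^ 2 ≤ a * r) := by
  have e2 : ‖c‖ ^ 2 = c.re ^ 2 + c.im ^ 2 := by rw [Complex.sq_norm, Complex.normSq_apply]; ring
  constructor
  · intro h
    have hr : 0 ≤ r := by simpa using h 0
    refine ⟨hr, ?_⟩
    -- test the pencil on the ray `s = t·conj c`, `t ∈ ℝ`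
    have key : ∀ t : ℝ, 0 ≤ a * ‖c‖ ^ 2 * t ^ 2 + 2 * ‖c‖ ^ 2 * t + r := by
      intro t
      have h1 := h ((t : ℂ) * conj c)
      have hn : ‖(t : ℂ) * conj c‖ ^ 2 = ‖c‖ ^ 2 * t ^ 2 := by
        rw [norm_mul, Complex.norm_conj, Complex.norm_real, Real.norm_eq_abs, mul_pow, sq_abs]; ring
      have hre : ((t : ℂ) * conj c * c).re = ‖c‖ ^ 2 * t := by
        rw [mul_assoc, Complex.conj_mul' c, ← Complex.ofReal_pow, ← Complex.ofReal_mul, Complex.ofReal_re]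
        ring
      rw [hn, hre] at h1
      have e : a * (‖c‖ ^ 2 * t ^ 2) + 2 * (‖c‖ ^ 2 * t) + r = a * ‖c‖ ^ 2 * t ^ 2 + 2 * ‖c‖ ^ 2 * t + r := by
        ring
      rw [e] at h1
      exact h1
    rcases eq_or_ne c 0 with hc0 | hc0
    · rw [hc0, norm_zero]; simpa using mul_nonneg ha hr
    · have hcn : 0 < ‖c‖ := norm_pos_iff.2 hc0
      rcases eq_or_lt_of_le ha with ha0 | hapos
      · -- `a = 0`, `c ≠ 0`: the pencil is affine in `t` with positive slope — impossible
        exfalso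
        have h1 := key (-(r + 1) / (2 * ‖c‖ ^ 2))
        rw [← ha0] at h1
        have hcn' : ‖c‖ ≠ 0 := hcn.ne'
        have e : 2 * ‖c‖ ^ 2 * (-(r + 1) / (2 * ‖c‖ ^ 2)) = -(r + 1) := by
          field_simp
        rw [zero_mul, zero_mul, zero_add, e] at h1
        linarith
      · -- `a > 0`: evaluate at `t = −1/a`
        have h1 := key (-1 / a)
        have hne : a ≠ 0 := hapos.ne'
        have e : a * ‖c‖ ^ 2 * (-1 / a) ^ 2 + 2 * ‖c‖ ^ 2 * (-1 / a) + r = r - ‖c‖ ^ 2 / a := by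
          field_simp
          ring
        rw [e, sub_nonneg, div_le_iff₀ hapos] at h1
        linarith
  · rintro ⟨hr, hcs⟩ s
    have e1 : ‖s‖ ^ 2 = s.re ^ 2 + s.im ^ 2 := by rw [Complex.sq_norm, Complex.normSq_apply]; ring
    have e3 : (s * c).re = s.re * c.re - s.im * c.im := Complex.mul_re _ _
    rw [e1, e3]
    rw [e2] at hcs
    rcases eq_or_lt_of_le ha with ha0 | hapos
    · rw [← ha0] at hcs ⊢
      have hc1 : c.re = 0 := by nlinarith [sq_nonneg c.re, sq_nonneg c.im]
      have hc2 : c.im = 0 := by nlinarith [sq_nonneg c.re, sq_nonneg c.im]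
      rw [hc1, hc2]; linarith
    · have key : 0 ≤ a * (a * (s.re ^ 2 + s.im ^ 2) + 2 * (s.re * c.re - s.im * c.im) + r) := by
        nlinarith [sq_nonneg (a * s.re + c.re), sq_nonneg (a * s.im - c.im)]
      exact (mul_nonneg_iff_of_pos_left hapos).1 key

/-- NULL on a piece class `V`: the completed two-piece constant is `≥ 0` on every design `s·u ⊕ v`, `u` in class,
`v ∈ V` (p442741's `Null θ X` is the instance `V = OverhangPiece θ`). Candidate shape, NOT asserted.
[cite: Zhang2022LandauSiegel, Prop 7.1 p.44, (7.2)] -/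
def NullOn (V : PieceClass) (θ : ℝ) (X : PairFunctional) : Prop :=
  ∀ (u u' v v' : ℝ → ℂ) (s : ℂ), InClassPiece u u' → V v v' → 0 ≤ twoPieceMainTerm θ X u u' v v' s

/-- CLOSES BY POSITIVITY on a piece class `V`: some design of the class has a NEGATIVE completed constant in the
`X`-world (p442741's `ClosesByPositivity θ X` is the instance `V = OverhangPiece θ`). Candidate shape, NOT asserted.
[cite: Zhang2022LandauSiegel, Prop 7.1 p.44, (7.2)] -/
def ClosesByPositivityOn (V : PieceClass) (θ : ℝ) (X : PairFunctional) : Prop :=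
  ∃ (u u' v v' : ℝ → ℂ) (s : ℂ), InClassPiece u u' ∧ V v v' ∧ twoPieceMainTerm θ X u u' v v' s < 0

/-- **Slot E*-band (cell registry row E-005), DISPLAYED, NOT asserted:** on the class `V` every net overhang block
is `≥ 0` in the `X`-world — the sign that the positivity (B1) of the discrete mean would force on a correctly derived
main term (a LEVER of the cell's LEVERS §0.6, not a theorem of the tree); an `X` violating it is an estimate of
E*-strength. [cite: Zhang2022LandauSiegel, Prop 7.1 p.44, (7.2)] -/
def BandNonnegOn (V : PieceClass) (θ : ℝ) (X : PairFunctional) : Prop :=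
  ∀ v v' : ℝ → ℂ, V v v' → 0 ≤ netOverhangBlock θ X v v'

/-- **Slot E*-cross (cell registry row E-006), DISPLAYED, NOT asserted:** on the class `V` every cross residual is
Cauchy–Schwarz-subordinate to the bulk form and the net overhang block, `‖c_X(u,v)‖² ≤ 𝔅(u)·r_X(v)`; its failure —
a bulk × band correlation of E*-strength — is the lever located by `closesOn_needs_cross`.
[cite: Zhang2022LandauSiegel, Prop 7.1 p.44, (7.2)] -/
def CrossSubordinateOn (V : PieceClass) (θ : ℝ) (X : PairFunctional) : Prop :=
  ∀ u u' v v' : ℝ → ℂ, InClassPiece u u' → V v v' →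
    ‖crossResidual θ X u u' v v'‖ ^ 2 ≤ mainTermForm u u' * netOverhangBlock θ X v v'

variable {V W : PieceClass} {X : PairFunctional}

/-- Closing by positivity is the failure of the null, on any class. [cite: Zhang2022LandauSiegel, Prop 7.1 p.44, (7.2)] -/
theorem closesByPositivityOn_iff_not_nullOn : ClosesByPositivityOn V θ X ↔ ¬ NullOn V θ X := by
  unfold ClosesByPositivityOn NullOn
  push Not
  constructor
  · rintro ⟨u, u', v, v', s, hu, hv, h⟩; exact ⟨u, u', v, v', s, hu, hv, h⟩
  · rintro ⟨u, u', v, v', s, hu, hv, h⟩; exact ⟨u, u', v, v', s, hu, hv, h⟩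

/-- **THE EXACT CRITERION** (any piece class `V`, any `θ`, any `X`): the completed two-piece form is `≥ 0` on every
design of the class iff every net overhang block is `≥ 0` and every cross residual is Cauchy–Schwarz-subordinate
(`‖c_X(u,v)‖² ≤ 𝔅(u)·r_X(v)`, an inequality with `≤` that also covers the kernel modes `𝔅(u) = 0`).
[cite: Zhang2022LandauSiegel, Prop 7.1 p.44, (7.2)] -/
theorem nullOn_iff : NullOn V θ X ↔ BandNonnegOn V θ X ∧ CrossSubordinateOn V θ X := by
  constructor
  · intro h
    have crit : ∀ u u' v v', InClassPiece u u' → V v v' →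
        0 ≤ netOverhangBlock θ X v v'
          ∧ ‖crossResidual θ X u u' v v'‖ ^ 2 ≤ mainTermForm u u' * netOverhangBlock θ X v v' := by
      intro u u' v v' hu hv
      refine (quadratic_nonneg_iff (mainTermForm_nonneg_of_isH1 hu.kinked.isH1)).1 fun s => ?_
      rw [← twoPieceMainTerm_eq_pencil]
      exact h u u' v v' s hu hv
    exact ⟨fun v v' hv => (crit _ _ v v' inClassPiece_zero hv).1, fun u u' v v' hu hv => (crit u u' v v' hu hv).2⟩
  · rintro ⟨hB, hC⟩ u u' v v' s hu hv
    rw [twoPieceMainTerm_eq_pencil]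
    exact (quadratic_nonneg_iff (mainTermForm_nonneg_of_isH1 hu.kinked.isH1)).2 ⟨hB v v' hv, hC u u' v v' hu hv⟩ s

/-- On an in-class KERNEL MODE (`𝔅(u) = 0`, e.g. `g⋆`: `Repair.mainTermForm_gStar`) the cross slot forces the cross
residual to VANISH: `X(u,v) = −π·conj(Φ_v)·L(u)` exactly (p442741's `kernelModeCancellation_of_null`, now for any
piece class). [cite: Zhang2022LandauSiegel, Prop 7.1 p.44, (7.2)] -/
theorem crossResidual_eq_zero_of_kernelMode (hC : CrossSubordinateOn V θ X) (hu : InClassPiece u u')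
    (hv : V v v') (h0 : mainTermForm u u' = 0) : crossResidual θ X u u' v v' = 0 := by
  have h := hC u u' v v' hu hv
  rw [h0, zero_mul] at h
  have : ‖crossResidual θ X u u' v v'‖ ^ 2 = 0 := le_antisymm h (sq_nonneg _)
  exact norm_eq_zero.1 (pow_eq_zero_iff two_ne_zero |>.1 this)

/-- Monotonicity: a null on a larger class restricts. [cite: Zhang2022LandauSiegel, Prop 7.1 p.44, (7.2)] -/
theorem NullOn.mono (hVW : ∀ v v', V v v' → W v v') (h : NullOn W θ X) : NullOn V θ X :=
  fun u u' v v' s hu hv => h u u' v v' s hu (hVW v v' hv)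

/-- Monotonicity: closing on a smaller class closes on a larger one. [cite: Zhang2022LandauSiegel, Prop 7.1 p.44, (7.2)] -/
theorem ClosesByPositivityOn.mono (hVW : ∀ v v', V v v' → W v v') (h : ClosesByPositivityOn V θ X) :
    ClosesByPositivityOn W θ X := by
  obtain ⟨u, u', v, v', s, hu, hv, hlt⟩ := h
  exact ⟨u, u', v, v', s, hu, hVW v v' hv, hlt⟩

/-! ### Part 4 — the verdict on a class and where the lever sits -/

/-- **NO CLOSING (any class).** If the net overhang blocks are `≥ 0` (slot E*-band with its (B1) sign) and the cross
residuals are subordinate (slot E*-cross), no design of the class closes by positivity.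
[cite: Zhang2022LandauSiegel, Prop 7.1 p.44, (7.2)] -/
theorem not_closesOn (hB : BandNonnegOn V θ X) (hC : CrossSubordinateOn V θ X) : ¬ ClosesByPositivityOn V θ X :=
  fun h => (closesByPositivityOn_iff_not_nullOn.1 h) (nullOn_iff.2 ⟨hB, hC⟩)

/-- **THE LEVER, LOCATED (any class).** A design that closes by positivity in an `X`-world whose net overhang blocks
are `≥ 0` exhibits an in-class piece `u` and a piece `v ∈ V` whose cross residual BEATS the geometric mean:
`𝔅(u)·r_X(v) < ‖c_X(u,v)‖²` — an off-diagonal bulk × band correlation of E*-strength. [cite: Zhang2022LandauSiegel, Prop 7.1 p.44, (7.2)] -/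
theorem closesOn_needs_cross (h : ClosesByPositivityOn V θ X) (hB : BandNonnegOn V θ X) :
    ∃ u u' v v' : ℝ → ℂ, InClassPiece u u' ∧ V v v' ∧
      mainTermForm u u' * netOverhangBlock θ X v v' < ‖crossResidual θ X u u' v v'‖ ^ 2 := by
  by_contra hcon
  push Not at hcon
  exact not_closesOn hB (fun u u' v v' hu hv => hcon u u' v v' hu hv) h

/-- **VERDICT ON THE ROUGH (non-smooth / multi-piece) TWO-PIECE CLASS, slot-conditional**: for every length `θ` and
every off-diagonal world `X` in which the band blocks of rough overhang pieces are `≥ 0` (E-005 with its (B1) sign)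
and the bulk × band cross residuals are subordinate (E-006), no design `s·u ⊕ v` (`u` in class, `v` rough) has a
negative completed constant. [cite: Zhang2022LandauSiegel, Prop 7.1 p.44, (7.2)] -/
theorem rough_not_closes (hB : BandNonnegOn (RoughOverhangPiece θ) θ X)
    (hC : CrossSubordinateOn (RoughOverhangPiece θ) θ X) : ¬ ClosesByPositivityOn (RoughOverhangPiece θ) θ X :=
  not_closesOn hB hC

/-- … and conversely, closing in the rough class with band blocks `≥ 0` needs a cross term of E*-strength.
[cite: Zhang2022LandauSiegel, Prop 7.1 p.44, (7.2)] -/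
theorem rough_closes_needs_cross (h : ClosesByPositivityOn (RoughOverhangPiece θ) θ X)
    (hB : BandNonnegOn (RoughOverhangPiece θ) θ X) :
    ∃ u u' v v' : ℝ → ℂ, InClassPiece u u' ∧ RoughOverhangPiece θ v v' ∧
      mainTermForm u u' * netOverhangBlock θ X v v' < ‖crossResidual θ X u u' v v'‖ ^ 2 :=
  closesOn_needs_cross h hB

/-- **The family «rough two-piece, any length `θ ≥ 1`, `X`-world currency»** for the extension protocol of
`RepairRplus`: designs `(θ, u, u′, v, v′, s)`; class = `1 ≤ θ ∧ InClassPiece u u′ ∧ RoughOverhangPiece θ v v′`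
(NO analytic hypothesis inside the class); verdict = for EVERY `X`-world carrying the two DISPLAYED slots
`BandNonnegOn` (E-005) and `CrossSubordinateOn` (E-006) on the rough class, `¬ (twoPieceMainTerm θ X u u′ v v′ s < 0)`.
[cite: Zhang2022LandauSiegel, §7 (7.2) p.44] -/
def familyRoughTwoPiece : DesignFamily where
  Design := ℝ × (ℝ → ℂ) × (ℝ → ℂ) × (ℝ → ℂ) × (ℝ → ℂ) × ℂ
  InClass p := 1 ≤ p.1 ∧ InClassPiece p.2.1 p.2.2.1 ∧ RoughOverhangPiece p.1 p.2.2.2.1 p.2.2.2.2.1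
  Verdict p := ∀ X : PairFunctional, BandNonnegOn (RoughOverhangPiece p.1) p.1 X →
    CrossSubordinateOn (RoughOverhangPiece p.1) p.1 X →
      ¬ (twoPieceMainTerm p.1 X p.2.1 p.2.2.1 p.2.2.2.1 p.2.2.2.2.1 p.2.2.2.2.2 < 0)

/-- **The rough two-piece family is decided** (by the exact criterion). [cite: Zhang2022LandauSiegel, §7 (7.2) p.44] -/
theorem familyRoughTwoPiece_decided : familyRoughTwoPiece.Decided :=
  fun _ h _ hB hC => not_lt.2 (nullOn_iff.2 ⟨hB, hC⟩ _ _ _ _ _ h.2.1 h.2.2)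

/-- **`R⁺⁺ := R⁺ ++ [rough two-piece]` is decided** (`Repair.rplus_extend`). [cite: Zhang2022LandauSiegel, §7 (7.2) p.44] -/
theorem rplus_rough_decided : ClassDecided (Rplus ++ [familyRoughTwoPiece]) :=
  rplus_extend familyRoughTwoPiece_decided

/-- The family verdict, unbundled (every hypothesis a binder). [cite: Zhang2022LandauSiegel, §7 (7.2) p.44] -/
theorem not_repairable_rough_twoPiece (hθ : 1 ≤ θ) (hu : InClassPiece u u') (hv : RoughOverhangPiece θ v v')
    (s : ℂ) (X : PairFunctional) (hB : BandNonnegOn (RoughOverhangPiece θ) θ X)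
    (hC : CrossSubordinateOn (RoughOverhangPiece θ) θ X) : ¬ (twoPieceMainTerm θ X u u' v v' s < 0) :=
  familyRoughTwoPiece_decided ⟨θ, u, u', v, v', s⟩ ⟨hθ, hu, hv⟩ X hB hC

/-! ### Part 5 — the smooth class of p442741 is the sub-class; invisibility = both slots with value `0` -/

/-- A smooth overhang piece (p442741) is a rough overhang piece. [cite: Zhang2022LandauSiegel, Prop 7.1 p.44, (7.2)] -/
theorem OverhangPiece.rough (hv : OverhangPiece θ v v') : RoughOverhangPiece θ v v' where
  memLp := by
    obtain ⟨C, hC⟩ := isCompact_Icc.exists_bound_of_continuousOn hv.cont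
    have hsub : Ioc 1 θ ⊆ Icc 0 θ := fun t ht => ⟨zero_le_one.trans ht.1.le, ht.2⟩
    refine MemLp.of_bound ((hv.cont.mono hsub).aestronglyMeasurable measurableSet_Ioc) C ?_
    filter_upwards [ae_restrict_mem measurableSet_Ioc] with t ht using hC t (hsub ht)
  memLp' := hv.memLp
  pwDeriv := ⟨∅, fun x hx _ => hv.hasDeriv x hx⟩
  vanish := fun y hy => hv.vanish y hy.le
  vanish' := hv.vanish'

/-- p442741's `Null` is the instance `V = OverhangPiece θ`. [cite: Zhang2022LandauSiegel, Prop 7.1 p.44, (7.2)] -/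
theorem null_iff_nullOn : Null θ X ↔ NullOn (OverhangPiece θ) θ X := Iff.rfl

/-- p442741's `ClosesByPositivity` is the instance `V = OverhangPiece θ`. [cite: Zhang2022LandauSiegel, Prop 7.1 p.44, (7.2)] -/
theorem closesByPositivity_iff_closesOn : ClosesByPositivity θ X ↔ ClosesByPositivityOn (OverhangPiece θ) θ X :=
  Iff.rfl

/-- EXTENSION: a null on the rough class is a null on the smooth class. [cite: Zhang2022LandauSiegel, Prop 7.1 p.44, (7.2)] -/
theorem null_of_roughNull (h : NullOn (RoughOverhangPiece θ) θ X) : Null θ X :=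
  h.mono fun _ _ hv => hv.rough

/-- EXTENSION: a smooth design that closes by positivity closes in the rough class. [cite: Zhang2022LandauSiegel, Prop 7.1 p.44, (7.2)] -/
theorem roughCloses_of_closes (h : ClosesByPositivity θ X) : ClosesByPositivityOn (RoughOverhangPiece θ) θ X :=
  ClosesByPositivityOn.mono (fun _ _ hv => hv.rough) h

/-- INVISIBILITY (p442741's `InvisibleOverhang`) is exactly: cross residual `0` and net overhang block `0` on the
smooth class. [cite: Zhang2022LandauSiegel, Prop 7.1 p.44, (7.2)] -/
theorem invisibleOverhang_iff :
    InvisibleOverhang θ X ↔ ∀ u u' v v' : ℝ → ℂ, InClassPiece u u' → OverhangPiece θ v v' →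
      crossResidual θ X u u' v v' = 0 ∧ netOverhangBlock θ X v v' = 0 := by
  unfold InvisibleOverhang crossResidual netOverhangBlock
  constructor
  · intro h u u' v v' hu hv
    obtain ⟨h1, h2⟩ := h u u' v v' hu hv
    exact ⟨by rw [h1, add_neg_cancel], h2⟩
  · intro h u u' v v' hu hv
    obtain ⟨h1, h2⟩ := h u u' v v' hu hv
    exact ⟨by linear_combination h1, h2⟩

/-- … hence both slots hold (with equality) in the invisible world. [cite: Zhang2022LandauSiegel, Prop 7.1 p.44, (7.2)] -/
theorem slots_of_invisible (h : InvisibleOverhang θ X) :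
    BandNonnegOn (OverhangPiece θ) θ X ∧ CrossSubordinateOn (OverhangPiece θ) θ X := by
  rw [invisibleOverhang_iff] at h
  refine ⟨fun v v' hv => ?_, fun u u' v v' hu hv => ?_⟩
  · rw [(h _ _ v v' inClassPiece_zero hv).2]
  · obtain ⟨h1, h2⟩ := h u u' v v' hu hv
    rw [h1, h2, norm_zero, mul_zero]
    norm_num

/-- p442741's `not_closes_of_invisible`, recovered as the case `c_X = 0`, `r_X = 0` of `not_closesOn`.
[cite: Zhang2022LandauSiegel, Prop 7.1 p.44, (7.2)] -/
theorem not_closes_of_invisible' (h : InvisibleOverhang θ X) : ¬ ClosesByPositivity θ X :=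
  not_closesOn (slots_of_invisible h).1 (slots_of_invisible h).2

/-! ### Part 6 — non-vacuity: the plateau (jump at the wall and at the top) and its continued-calculus data -/

section Plateau

/-- The PLATEAU overhang `𝟙_[1,θ)`: jump `+1` at the wall `z = 1`, jump `−1` at the top `z = θ`.
[cite: Zhang2022LandauSiegel, Prop 7.1 p.44, (7.2)] -/
def plateau (θ : ℝ) : ℝ → ℂ := (Ico 1 θ).indicator fun _ => 1

/-- `𝟙_[1,θ)(t) = 1` on `[1,θ)`. [cite: Zhang2022LandauSiegel, Prop 7.1 p.44, (7.2)] -/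
theorem plateau_of_mem {t : ℝ} (ht : t ∈ Ico 1 θ) : plateau θ t = 1 := by
  rw [plateau, indicator_of_mem ht]

/-- `𝟙_[1,θ)(t) = 0` off `[1,θ)`. [cite: Zhang2022LandauSiegel, Prop 7.1 p.44, (7.2)] -/
theorem plateau_of_not_mem {t : ℝ} (ht : t ∉ Ico 1 θ) : plateau θ t = 0 := by
  rw [plateau, indicator_of_notMem ht]

/-- The plateau is a rough overhang piece (companion derivative `0`). [cite: Zhang2022LandauSiegel, Prop 7.1 p.44, (7.2)] -/
theorem roughOverhangPiece_plateau (θ : ℝ) : RoughOverhangPiece θ (plateau θ) (fun _ => 0) where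
  memLp := by
    refine MemLp.of_bound (aestronglyMeasurable_const.indicator measurableSet_Ico) 1 ?_
    filter_upwards with t
    by_cases ht : t ∈ Ico 1 θ
    · rw [plateau_of_mem ht]; simp
    · rw [plateau_of_not_mem ht]; simp
  memLp' := by simp
  pwDeriv := by
    refine ⟨∅, fun x hx _ => ?_⟩
    have hconst : HasDerivWithinAt (fun _ : ℝ => (1:ℂ)) 0 (Ioi x) x := hasDerivWithinAt_const x (Ioi x) 1
    refine hconst.congr_of_eventuallyEq ?_ (plateau_of_mem hx)
    have hmem : Iio θ ∈ nhdsWithin x (Ioi x) := mem_nhdsWithin_of_mem_nhds (Iio_mem_nhds hx.2)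
    filter_upwards [hmem, self_mem_nhdsWithin] with t ht1 ht2
    exact plateau_of_mem ⟨hx.1.trans (le_of_lt ht2), ht1⟩
  vanish := fun y hy => plateau_of_not_mem fun h => not_le.2 hy h.1
  vanish' := fun _ _ => rfl

/-- Overhang mass of the plateau: `Φ = θ − 1` (`θ ≥ 1`). [cite: Zhang2022LandauSiegel, Prop 7.1 p.44, (7.2)] -/
theorem overhangMass_plateau (hθ : 1 ≤ θ) : overhangMass θ (plateau θ) = ((θ - 1 : ℝ) : ℂ) := by
  rw [overhangMass, intervalIntegral.integral_congr_uIoo (g := fun _ => (1:ℂ)) fun t ht => ?_,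
    intervalIntegral.integral_const, Complex.real_smul, mul_one]
  rw [uIoo_of_le hθ] at ht
  exact plateau_of_mem ⟨ht.1.le, ht.2⟩

/-- The kernel mode `g⋆` against the plateau: `M_θ(g⋆, 𝟙_[1,θ)) = 24π(θ−1)`, `M_θ(𝟙_[1,θ), g⋆) = 0`
(`rough_rankOneTailCoupling` with `L(g⋆) = 24`). [cite: Zhang2022LandauSiegel, Prop 7.1 p.44, (7.2)] -/
theorem MformTop_gStar_plateau (hθ : 1 ≤ θ) :
    MformTop θ gStar gStar' (plateau θ) (fun _ => 0) = 24 * (π : ℂ) * ((θ - 1 : ℝ) : ℂ)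
    ∧ MformTop θ (plateau θ) (fun _ => 0) gStar gStar' = 0 := by
  obtain ⟨h1, h2⟩ := rough_rankOneTailCoupling hθ inClassPiece_gStar (roughOverhangPiece_plateau θ)
  refine ⟨?_, h2⟩
  rw [h1, overhangMass_plateau hθ, tailFunctional_gStar, Complex.conj_ofReal]
  ring

/-- Tail of the plateau from inside: `∫_y^θ 𝟙 = θ − y` for `1 ≤ y ≤ θ`. [cite: Zhang2022LandauSiegel, Prop 7.1 p.44, (7.2)] -/
theorem tail_plateau {y : ℝ} (hy : 1 ≤ y) (hyθ : y ≤ θ) : ∫ t in y..θ, plateau θ t = ((θ - y : ℝ) : ℂ) := by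
  rw [intervalIntegral.integral_congr_uIoo (g := fun _ => (1:ℂ)) fun t ht => ?_,
    intervalIntegral.integral_const, Complex.real_smul, mul_one]
  rw [uIoo_of_le hyθ] at ht
  exact plateau_of_mem ⟨hy.trans ht.1.le, ht.2⟩

/-- One `j`-summand of `M_θ(𝟙,𝟙)`: `∫₀^θ D_j = π²jS_j(θ−1) + iπ³jN_j(θ−1)²/2`.
[cite: Zhang2022LandauSiegel, Prop 7.1 p.44, (8.11)–(8.12)] -/
theorem integral_dipoleIntegrandTop_plateau (hθ : 1 ≤ θ) (j : ℕ) :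
    ∫ y in (0:ℝ)..θ, dipoleIntegrandTop θ j (plateau θ) (fun _ => 0) (plateau θ) (fun _ => 0) y
      = ((π ^ 2 * j * bS j * (θ - 1) : ℝ) : ℂ) + I * ((π ^ 3 * j * bN j * ((θ - 1) ^ 2 / 2) : ℝ) : ℂ) := by
  set D := dipoleIntegrandTop θ j (plateau θ) (fun _ => 0) (plateau θ) (fun _ => 0) with hD
  -- below the wall the integrand vanishes
  have hEq1 : EqOn D (fun _ => (0:ℂ)) (uIoo 0 1) := by
    intro y hy
    rw [uIoo_of_le zero_le_one] at hy
    have : plateau θ y = 0 := plateau_of_not_mem fun h => not_le.2 hy.2 h.1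
    simp only [hD, dipoleIntegrandTop, this]
    ring
  -- on the plateau it is affine in `y`
  set F : ℝ → ℂ := fun y => ((π ^ 2 * j * bS j : ℝ) : ℂ) + I * ((π ^ 3 * j * bN j : ℝ) : ℂ) * ((θ - y : ℝ) : ℂ)
    with hF
  have hEq2 : EqOn D F (uIoo 1 θ) := by
    intro y hy
    rw [uIoo_of_le hθ] at hy
    have h1 : plateau θ y = 1 := plateau_of_mem ⟨hy.1.le, hy.2⟩
    simp only [hD, dipoleIntegrandTop, h1, tail_plateau hy.1.le hy.2.le, hF, map_add, map_mul,
      Complex.conj_I, Complex.conj_ofReal, map_pow, zero_add, mul_one]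
    push_cast
    have hI : I * I = -1 := Complex.I_mul_I
    linear_combination (-(π : ℂ) ^ 2 * (j : ℂ) * ((bS j : ℝ) : ℂ)) * hI
  have i1 : IntervalIntegrable D volume 0 1 := (intervalIntegrable_const (c := (0:ℂ))).congr_uIoo hEq1.symm
  have hFc : Continuous F := by rw [hF]; fun_prop
  have i2 : IntervalIntegrable D volume 1 θ := (hFc.intervalIntegrable 1 θ).congr_uIoo hEq2.symm
  -- the elementary integral of the affine piece
  have e1 : ∫ y in (1:ℝ)..θ, ((θ - y : ℝ) : ℂ) = ((((θ - 1) ^ 2 / 2 : ℝ)) : ℂ) := by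
    rw [intervalIntegral.integral_ofReal, intervalIntegral.integral_sub intervalIntegrable_const
      intervalIntegrable_id, intervalIntegral.integral_const, integral_id, smul_eq_mul]
    push_cast
    ring
  have iA : IntervalIntegrable (fun _ : ℝ => (((π ^ 2 * j * bS j : ℝ)) : ℂ)) volume 1 θ := intervalIntegrable_const
  have iB : IntervalIntegrable (fun y : ℝ => I * ((π ^ 3 * j * bN j : ℝ) : ℂ) * ((θ - y : ℝ) : ℂ)) volume 1 θ :=
    (Continuous.intervalIntegrable (by fun_prop) 1 θ)
  have hInt : ∫ y in (1:ℝ)..θ, F y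
      = ((π ^ 2 * j * bS j * (θ - 1) : ℝ) : ℂ) + I * ((π ^ 3 * j * bN j * ((θ - 1) ^ 2 / 2) : ℝ) : ℂ) := by
    rw [hF, intervalIntegral.integral_add iA iB, intervalIntegral.integral_const, intervalIntegral.integral_const_mul,
      e1, Complex.real_smul]
    push_cast
    ring
  rw [← intervalIntegral.integral_add_adjacent_intervals i1 i2, intervalIntegral.integral_congr_uIoo hEq1,
    intervalIntegral.integral_zero, zero_add, intervalIntegral.integral_congr_uIoo hEq2, hInt]

/-- **The plateau's continued diagonal form**: `M_θ(𝟙_[1,θ), 𝟙_[1,θ)) = 32π(θ−1) + 12π²(θ−1)²·i`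
(`Σ_j W_j j S_j = 32`, `Σ_j W_j j N_j = 24`). [cite: Zhang2022LandauSiegel, Prop 7.1 p.44, (8.11)–(8.12)] -/
theorem MformTop_plateau (hθ : 1 ≤ θ) :
    MformTop θ (plateau θ) (fun _ => 0) (plateau θ) (fun _ => 0)
      = ((32 * π * (θ - 1) : ℝ) : ℂ) + I * ((12 * π ^ 2 * (θ - 1) ^ 2 : ℝ) : ℂ) := by
  unfold MformTop
  rw [integral_dipoleIntegrandTop_plateau hθ 1, integral_dipoleIntegrandTop_plateau hθ 2,
    integral_dipoleIntegrandTop_plateau hθ 3, bN_one, bN_two, bN_three, bS_one, bS_two, bS_three]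
  have hπ : (π : ℂ) ≠ 0 := by exact_mod_cast Real.pi_ne_zero
  push_cast
  field_simp
  ring

/-- … so in the continued calculus the plateau's net overhang block is `r_0(𝟙_[1,θ)) = 64π(θ−1)` (`≥ 0` for
`θ ≥ 1`: on this member the band slot holds in the world `X = 0`). [cite: Zhang2022LandauSiegel, Prop 7.1 p.44, (7.2)] -/
theorem netOverhangBlock_zero_plateau (hθ : 1 ≤ θ) :
    netOverhangBlock θ 0 (plateau θ) (fun _ => 0) = 64 * π * (θ - 1) := by
  unfold netOverhangBlock
  rw [topDiagForm_re, MformTop_plateau hθ]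
  have e : ((0 : PairFunctional) (plateau θ) (fun _ => 0) (plateau θ) (fun _ => 0)) = 0 := rfl
  rw [e, Complex.zero_re, mul_zero, add_zero, Complex.add_re, Complex.ofReal_re, Complex.I_mul_re,
    Complex.ofReal_im]
  ring

/-- For `θ > 1` the plateau is NOT a smooth overhang piece (it jumps at the wall), while `Repair.phiT θ` is both
(`overhangPiece_phiT`, `OverhangPiece.rough`): the rough class is STRICTLY larger than p442741's.
[cite: Zhang2022LandauSiegel, Prop 7.1 p.44, (7.2)] -/
theorem not_overhangPiece_plateau (hθ : 1 < θ) (w : ℝ → ℂ) : ¬ OverhangPiece θ (plateau θ) w := by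
  intro hv
  have hc : ContinuousOn (fun t => (plateau θ t).re) (Icc 0 1) :=
    (Complex.continuous_re.comp_continuousOn hv.cont).mono (Icc_subset_Icc_right hθ.le)
  have h0 : (plateau θ 0).re = 0 := by
    rw [plateau_of_not_mem fun h => by norm_num at h]; simp
  have h1 : (plateau θ 1).re = 1 := by rw [plateau_of_mem ⟨le_rfl, hθ⟩]; simp
  have hmem : (1/2 : ℝ) ∈ Icc ((fun t => (plateau θ t).re) 0) ((fun t => (plateau θ t).re) 1) := by
    simp only [h0, h1]; norm_num
  obtain ⟨x, _, hx⟩ := intermediate_value_Icc zero_le_one hc hmem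
  simp only at hx
  by_cases hxm : x ∈ Ico 1 θ
  · rw [plateau_of_mem hxm] at hx; norm_num at hx
  · rw [plateau_of_not_mem hxm] at hx; norm_num at hx

/-- The smooth witness of p442741, `φ_θ`, is in both classes. [cite: Zhang2022LandauSiegel, Prop 7.1 p.44, (7.2)] -/
theorem roughOverhangPiece_phiT (hθ : 1 ≤ θ) : RoughOverhangPiece θ (phiT θ) (phiT' θ) :=
  (overhangPiece_phiT hθ).rough

/-- A member of `familyRoughTwoPiece` with an actual jump at the wall: `s·g⋆ ⊕ 𝟙_[1,θ)`, every `θ ≥ 1`, every `s`.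
[cite: Zhang2022LandauSiegel, Prop 7.1 p.44, (7.2)] -/
theorem familyRoughTwoPiece_inClass_gStar_plateau (hθ : 1 ≤ θ) (s : ℂ) :
    familyRoughTwoPiece.InClass ⟨θ, gStar, gStar', plateau θ, fun _ => 0, s⟩ :=
  ⟨hθ, inClassPiece_gStar, roughOverhangPiece_plateau θ⟩

end Plateau

/-! ### Part 7 — the slots are load-bearing: the world `X = 0` on the rough class (continued calculus only) -/

section ZeroWorld

/-- In the world `X = 0` the cross residual of `g⋆ ⊕ 𝟙_[1,θ)` is `24π(θ−1)` (the bare tail coupling).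
[cite: Zhang2022LandauSiegel, Prop 7.1 p.44, (7.2)] -/
theorem crossResidual_zero_gStar_plateau (hθ : 1 ≤ θ) :
    crossResidual θ 0 gStar gStar' (plateau θ) (fun _ => 0) = ((24 * π * (θ - 1) : ℝ) : ℂ) := by
  unfold crossResidual
  rw [overhangMass_plateau hθ, tailFunctional_gStar, Complex.conj_ofReal, Pi.zero_apply, Pi.zero_apply,
    Pi.zero_apply, Pi.zero_apply]
  push_cast
  ring

/-- In the world `X = 0` the two-piece constant of `s·g⋆ ⊕ 𝟙_[1,θ)` (`s` real) is AFFINE in `s`: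
`q_0(s) = 48π(θ−1)·s + 64π(θ−1)` (in-class block `𝔅(g⋆)|s|² = 0` by `Repair.mainTermForm_gStar`).
[cite: Zhang2022LandauSiegel, Prop 7.1 p.44, (7.2)] -/
theorem twoPieceMainTerm_zero_gStar_plateau (hθ : 1 ≤ θ) (s : ℝ) :
    twoPieceMainTerm θ 0 gStar gStar' (plateau θ) (fun _ => 0) (s : ℂ)
      = 48 * π * (θ - 1) * s + 64 * π * (θ - 1) := by
  rw [twoPieceMainTerm_eq_pencil, mainTermForm_gStar, crossResidual_zero_gStar_plateau hθ,
    netOverhangBlock_zero_plateau hθ, ← Complex.ofReal_mul, Complex.ofReal_re]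
  ring

/-- **The world `X = 0` closes by positivity on the rough class at every `θ > 1`, no cubic needed**: the member
`(−2)·g⋆ ⊕ 𝟙_[1,θ)` has constant `q_0(−2) = −32π(θ−1) < 0`. CURRENCY: a statement about the continued diagonal
calculus `Repair.MformTop θ` only (as `Repair.topForm_indefinite`); validity off `R`: registry E-017 open; the world
`X = 0` is not the (A)-world (no one asserts it beyond `P`). [cite: Zhang2022LandauSiegel, Prop 7.1 p.44, (7.2)] -/
theorem rough_closesByPositivity_zero (hθ : 1 < θ) : ClosesByPositivityOn (RoughOverhangPiece θ) θ 0 := by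
  refine ⟨gStar, gStar', plateau θ, fun _ => 0, ((-2 : ℝ) : ℂ), inClassPiece_gStar, roughOverhangPiece_plateau θ,
    ?_⟩
  rw [twoPieceMainTerm_zero_gStar_plateau hθ.le]
  have hπ : 0 < π := Real.pi_pos
  nlinarith

/-- **The cross slot is load-bearing**: in the world `X = 0` the rough class VIOLATES `CrossSubordinateOn` at every
`θ > 1` (on the kernel mode `g⋆` the residual `24π(θ−1) ≠ 0` would have to vanish), while on the plateau member
the band slot holds (`netOverhangBlock_zero_plateau`): E-006 is what a closing design must break here.
[cite: Zhang2022LandauSiegel, Prop 7.1 p.44, (7.2)] -/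
theorem not_crossSubordinateOn_rough_zero (hθ : 1 < θ) : ¬ CrossSubordinateOn (RoughOverhangPiece θ) θ 0 := by
  intro hC
  have h0 := crossResidual_eq_zero_of_kernelMode hC inClassPiece_gStar (roughOverhangPiece_plateau θ)
    mainTermForm_gStar
  rw [crossResidual_zero_gStar_plateau hθ.le, Complex.ofReal_eq_zero] at h0
  have hπ : 0 < π := Real.pi_pos
  nlinarith

/-- … so the rough null FAILS in the world `X = 0` for every `θ > 1` (the two slots of `familyRoughTwoPiece`'s
verdict cannot both be deleted). [cite: Zhang2022LandauSiegel, Prop 7.1 p.44, (7.2)] -/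
theorem not_nullOn_rough_zero (hθ : 1 < θ) : ¬ NullOn (RoughOverhangPiece θ) θ 0 :=
  closesByPositivityOn_iff_not_nullOn.1 (rough_closesByPositivity_zero hθ)

end ZeroWorld

/-! ### Part 8 — the two displayed slots are JOINTLY INHABITED on the rough class (every `θ`): the cancelling world
(referee companion to the verdict of `familyRoughTwoPiece`, REF-E E-4; construction of the cell's referee probe
`probe-p457552-landed.lean`, re-proved in-tree) -/

section CancelWorld

open Classical in
/-- **The cancelling world** `X⁰_θ`: on the cross slot it returns `−π·conj(Φ_c)·L(a)` (so every cross residual off the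
diagonal vanishes), and on the diagonal `(a,b) = (c,d)` it adds the real correction that nets the overhang block to
`0`. A bookkeeping witness that the two slots of `familyRoughTwoPiece`'s verdict are jointly satisfiable — NOT a
claim that this is the (A)-world. [cite: Zhang2022LandauSiegel, Prop 7.1 p.44, (7.2)] -/
def cancelWorld (θ : ℝ) : PairFunctional := fun a b c d =>
  -((π : ℂ) * conj (overhangMass θ c) * tailFunctional a)
    + (if a = c ∧ b = d then
        (((-(topDiagForm θ c d).re / 2 + ((π : ℂ) * conj (overhangMass θ c) * tailFunctional c).re : ℝ)) : ℂ)
      else 0)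

/-- in the cancelling world every net overhang block is `0`. [cite: Zhang2022LandauSiegel, Prop 7.1 p.44, (7.2)] -/
theorem netOverhangBlock_cancelWorld (θ : ℝ) (v v' : ℝ → ℂ) : netOverhangBlock θ (cancelWorld θ) v v' = 0 := by
  simp only [netOverhangBlock, cancelWorld, and_self, if_true, Complex.add_re, Complex.neg_re, Complex.ofReal_re]
  ring

/-- … hence the band slot holds (with equality) on ANY piece class. [cite: Zhang2022LandauSiegel, Prop 7.1 p.44, (7.2)] -/
theorem bandNonnegOn_cancelWorld (V : PieceClass) (θ : ℝ) : BandNonnegOn V θ (cancelWorld θ) :=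
  fun v v' _ => by rw [netOverhangBlock_cancelWorld]

/-- off the diagonal the cross residual of the cancelling world vanishes. [cite: Zhang2022LandauSiegel, Prop 7.1 p.44, (7.2)] -/
theorem crossResidual_cancelWorld_of_ne {θ : ℝ} {u u' v v' : ℝ → ℂ} (h : ¬ (u = v ∧ u' = v')) :
    crossResidual θ (cancelWorld θ) u u' v v' = 0 := by
  simp only [crossResidual, cancelWorld, if_neg h]
  ring

/-- the continued form of the zero profile is `0`. [cite: Zhang2022LandauSiegel, Prop 7.1 p.44, (7.2)] -/
theorem MformTop_zero_profile (θ : ℝ) : MformTop θ 0 0 0 0 = 0 := by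
  simp [MformTop, dipoleIntegrandTop]

/-- A profile that is at once an in-class piece and a rough overhang piece is the zero profile (with zero companion):
in-class pieces vanish on `[1,∞)`, rough overhang pieces on `(−∞,1)`. [cite: Zhang2022LandauSiegel, Prop 7.1 p.44, (7.2)] -/
theorem eq_zero_of_inClass_of_rough {θ : ℝ} {u u' : ℝ → ℂ} (hu : InClassPiece u u') (hv : RoughOverhangPiece θ u u') :
    u = 0 ∧ u' = 0 := by
  refine ⟨funext fun y => ?_, funext fun y => ?_⟩
  · rcases lt_or_ge y 1 with hy | hy
    · exact hv.vanish y hy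
    · exact hu.vanish y hy
  · rcases lt_or_ge y 1 with hy | hy
    · exact hv.vanish' y hy
    · exact hu.vanish' y hy

/-- in the cancelling world the cross slot holds on the rough class (off the diagonal the residual is `0`; on the
diagonal the pair is the zero profile, where everything is `0`). [cite: Zhang2022LandauSiegel, Prop 7.1 p.44, (7.2)] -/
theorem crossSubordinateOn_cancelWorld (θ : ℝ) : CrossSubordinateOn (RoughOverhangPiece θ) θ (cancelWorld θ) := by
  intro u u' v v' hu hv
  by_cases h : u = v ∧ u' = v'
  · obtain ⟨rfl, rfl⟩ := h
    obtain ⟨rfl, rfl⟩ := eq_zero_of_inClass_of_rough hu hv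
    have hc : crossResidual θ (cancelWorld θ) 0 0 0 0 = 0 := by
      simp [crossResidual, cancelWorld, overhangMass, tailFunctional, topDiagForm, MformTop_zero_profile]
    rw [hc, netOverhangBlock_cancelWorld]
    simp
  · rw [crossResidual_cancelWorld_of_ne h, netOverhangBlock_cancelWorld]
    simp

/-- **The displayed hypotheses of `familyRoughTwoPiece`'s verdict are jointly satisfiable, for every `θ`** (slot
inhabited; together with `not_crossSubordinateOn_rough_zero` — slot load-bearing — the verdict is neither vacuous nor
idle). [cite: Zhang2022LandauSiegel, Prop 7.1 p.44, (7.2)] -/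
theorem exists_slots_rough (θ : ℝ) :
    ∃ X : PairFunctional, BandNonnegOn (RoughOverhangPiece θ) θ X ∧ CrossSubordinateOn (RoughOverhangPiece θ) θ X :=
  ⟨cancelWorld θ, bandNonnegOn_cancelWorld _ θ, crossSubordinateOn_cancelWorld θ⟩

/-- … so the rough null HOLDS in the cancelling world (the criterion, backwards). [cite: Zhang2022LandauSiegel, Prop 7.1 p.44, (7.2)] -/
theorem nullOn_rough_cancelWorld (θ : ℝ) : NullOn (RoughOverhangPiece θ) θ (cancelWorld θ) :=
  nullOn_iff.2 ⟨bandNonnegOn_cancelWorld _ θ, crossSubordinateOn_cancelWorld θ⟩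

end CancelWorld

end KnifeEdge

end Literature.NumberTheory.LFunctions.Zhang2022
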